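import Literature.NumberTheory.LFunctions.ConreyIwaniec2002Prop91Inputs
import Literature.NumberTheory.LFunctions.ConreyIwaniec2002IdealNormCount
import Literature.NumberTheory.LFunctions.ConreyIwaniec2002LOneTrivialLowerBound
import Literature.NumberTheory.LFunctions.ConreyIwaniec2002RootNumberQuotientUpper
import Literature.NumberTheory.LFunctions.ConreyIwaniec2002MollifierIdentity
import Literature.NumberTheory.LFunctions.HyperbolicBilinearMeanValue
import Literature.NumberTheory.LFunctions.ConreyIwaniec2002PrincipalEstimate
import HarnessLib

/-!
# Conrey–Iwaniec (2002), Proposition 9.1 in the range of its printed proof (`T ≥ q^65`, `log T ≥ (log q)²`) from Proposition 8.1 and Corollary 6.3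

Conrey–Iwaniec, *Spacing of zeros of Hecke L-functions and the class number problem*, Acta Arith.
103 (2002), §9 p. 20 [held text `paper:arxiv-math_0111012` p0020:L1–44]:

> **Proposition 9.1.** Let `S(T)` be a set of points satisfying (8.1)–(8.3) with `T ≥ 2`. Then
> `E(T) ≪ T(log q)^6 + Tℒ(T)^{1/2}(log T)²(log q)^{5/2}` (9.7), the implied constant absolute,

`E(T) = Σ_s|ℓ(s)M̄(s) − x(s)|` (9.6). PROVED HERE in the range of the printed proof — §8's standing
`T ≥ q^65` (p. 18: "we assume that `T ≥ q^65` to comply with the condition of Proposition 6.4") and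
`log T ≥ (log q)²` (where the printed term `(log T)Σ_s|B(s)| ≪ Tℒ(q)^{1/2}(log T)(log q)^{9/2}` is
absorbed by (9.7)) — from the two printed inputs it rests on, taken as hypotheses in the SAME
restricted range resp. as typed: Proposition 8.1 (8.10) (`_large` form; the typed
`conreyIwaniec2002_proposition81` implies it) and Corollary 6.3 (6.49) (the typed
`conreyIwaniec2002_corollary63`). The conclusion is VERBATIM the hypothesis `h1` of the tree's
`principalEstimate_of` (`ConreyIwaniec2002PrincipalEstimate.lean`), i.e. the binder through which
Proposition 9.2 (`conreyIwaniec2002_proposition92`) consumes Proposition 9.1: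
`prop91_large_of_prop81_large_corollary63`, `prop91_large_of_proposition81_corollary63`.

The proof is the printed one (p. 20 L1–38): `M(s)N(s) = 1 + B₁(s) + B₂(s)` (Möbius; tree
`shortInvSum_mul_shortLSum_sub_one`), `ℓM̄ − x = (ℓ − xN̄)M̄ + x·conj(MN − 1)`, Cauchy, the mollifier
mean square (tree `sum_norm_shortInvSum_sq_le`), `|x(s)| ≪ log q + log t` (tree `norm_xQuot_le`),
separation of variables + "Lemma 5.3" + Cauchy for `Σ_s|B_i(s)|` (tree
`HyperbolicSeparation.sum_norm_hyperbolic_bilinear_le`), `|λ|,|λ*| ≤ τ(·,χ) ≤ d(·)` (tree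
`idealNormCount_eq_norm_divisorSumChar_of_quadratic`), Corollary 6.3 on `(q²,q⁴]`, and the effective
`L(1,χ) ≥ π/√q` (tree `norm_LFunction_one_ge`) to absorb the remainder of (6.49); the real-variable
algebra is `prop91_algebra` (`ConreyIwaniec2002Prop91Algebra.lean`). Line `prop81-moebius-perron`
of cell landau-siegel/ls-inputs (SKELETON I6b fa4ad90e7f26b39e, critic gate PASS).

«The programme SEARCHES and TYPES; no claim about Landau–Siegel zeros, Theorems 1–2 of
arXiv:2211.02515 or a repaired Margin232 until a kernel theorem says so.»

## References
* [ConreyIwaniec2002] B. Conrey, H. Iwaniec, Acta Arith. 103 (2002) 259–312: §6 Corollary 6.3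
  (6.49)–(6.50); §8 p. 18, Proposition 8.1 (8.10); §9 (9.3)–(9.7), Proposition 9.1.
-/

noncomputable section

open scoped NumberField
open Complex

namespace Literature.NumberTheory.LFunctions

namespace ConreyIwaniec2002

open NumberField

/-! ### Kernel composition, step 5: Proposition 9.1 in the `_large` range from S1–S7 -/

/-- **KERNEL COMPOSITION (the line).** Proposition 8.1 (restricted, S1) ∧ Corollary 6.3 (S2) ∧ the
upper bound for `x(s)` (S3) ∧ the separated bilinear mean value bound (S4) ∧ `#{N𝔞 = n} = τ(n,χ)`
(S5) ∧ `L(1,χ) ≥ π/√q` (S6) ∧ `MN = 1 + B₁ + B₂` (S7), together with the TREE's mollifier mean square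
`sum_norm_shortInvSum_sq_le` and `Σ d(n)²/n ≤ (1 + log)⁴`, give **Proposition 9.1 (9.7) for
`T ≥ q^65`, `log T ≥ (log q)²`** — VERBATIM the binder `stub_prop91_large` (S1) of SKELETON I6
14fb27945d1f8917 — with `C = √(C₁C₂) + 15000·C₃C₄√C₅`.
[cite: ConreyIwaniec2002, Proposition 9.1 (9.7), proof p. 20 L1–44] -/
theorem prop91_large_of
    (h81 : ∃ C : ℝ, 0 < C ∧
      ∀ (q : ℕ) [NeZero q], 4 < q → Odd q → ∀ χ : DirichletCharacter ℂ q,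
        χ.IsPrimitive → χ.IsQuadratic → χ.Odd →
          ∀ (K : Type) [Field K] [NumberField K],
            Module.finrank ℚ K = 2 → NumberField.discr K = -(q : ℤ) →
              ∀ (ψ : ClassGroup (𝓞 K) →* ℂˣ) (T : ℝ) (S : Finset ℝ) (t' : ℝ → ℝ),
                (q : ℝ) ^ (65 : ℕ) ≤ T → Real.exp (Real.log q ^ (2 : ℕ)) ≤ T →
                  IsDyadicPointSet S T →
                  defectD K ψ q S t' ≤
                    C * (T * Real.log q ^ (7 : ℕ) + T * calL χ T * Real.log T ^ (4 : ℕ)))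
    (h63 : conreyIwaniec2002_corollary63)
    (hx : ∃ C : ℝ, 0 < C ∧ ∀ q : ℕ, 4 < q → ∀ t t' : ℝ, 2 ≤ t →
      ‖xQuot q (1 / 2 + t * I) (1 / 2 + t' * I)‖ ≤ C * (Real.log q + Real.log t))
    (hB : ∃ C : ℝ, 0 < C ∧
      ∀ (N X M₁ M₂ N₁ N₂ : ℕ) (a b : ℕ → ℂ) (T : ℝ) (S : Finset ℝ),
        1 ≤ M₁ → M₂ ≤ N → 1 ≤ N₁ → N₂ ≤ N → 2 ≤ X → 0 < T → (N : ℝ) ≤ T →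
          IsDyadicPointSet S T →
          ∑ t ∈ S, ‖∑ m ∈ Finset.Icc M₁ M₂, ∑ n ∈ Finset.Icc N₁ N₂,
              (if X < m * n then
                a m * (m : ℂ) ^ (-(1 / 2 + t * I)) * (b n * (n : ℂ) ^ (-(1 / 2 + t * I)))
               else 0)‖ ≤
            C * T * (1 + Real.log N) * (1 + Real.log X) *
              Real.sqrt (∑ m ∈ Finset.Icc M₁ M₂, ‖a m‖ ^ 2 / m) *
              Real.sqrt (∑ n ∈ Finset.Icc N₁ N₂, ‖b n‖ ^ 2 / n))
    (hid : ∀ {q : ℕ} [NeZero q] {χ : DirichletCharacter ℂ q},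
      χ.IsPrimitive → χ.IsQuadratic → χ.Odd →
        ∀ (K : Type) [Field K] [NumberField K],
          Module.finrank ℚ K = 2 → NumberField.discr K = -(q : ℤ) →
            ∀ {n : ℕ}, n ≠ 0 → (idealNormCount K n : ℝ) = ‖divisorSumChar χ n‖)
    (hL : ∀ (q : ℕ) [NeZero q], 4 < q → ∀ χ : DirichletCharacter ℂ q,
      χ.IsPrimitive → χ.IsQuadratic → χ.Odd →
        ∀ (K : Type) [Field K] [NumberField K],
          Module.finrank ℚ K = 2 → NumberField.discr K = -(q : ℤ) →
            Real.pi / Real.sqrt q ≤ ‖χ.LFunction 1‖)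
    (hMN : ∀ (K : Type) [Field K] [NumberField K] (ψ : ClassGroup (𝓞 K) →* ℂˣ) (q : ℕ),
      0 < q → ∀ s : ℂ,
        shortInvSum K ψ q s * shortLSum K ψ q s - 1 =
          (∑ m ∈ Finset.Icc (q ^ 2 + 1) (q ^ 4), ∑ n ∈ Finset.Icc 1 (q ^ 4),
            if q ^ 4 < m * n then
              twistMoebius K (classGroupCharIdealHom ψ) m * (m : ℂ) ^ (-s) *
                (twistCount K (classGroupCharIdealHom ψ) n * (n : ℂ) ^ (-s))
            else 0) +
          (∑ m ∈ Finset.Icc 1 (q ^ 2), ∑ n ∈ Finset.Icc (q ^ 2 + 1) (q ^ 4),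
            if q ^ 4 < m * n then
              twistMoebius K (classGroupCharIdealHom ψ) m * (m : ℂ) ^ (-s) *
                (twistCount K (classGroupCharIdealHom ψ) n * (n : ℂ) ^ (-s))
            else 0)) :
    ∃ C : ℝ, 0 < C ∧
    ∀ (q : ℕ) [NeZero q], 4 < q → Odd q → ∀ χ : DirichletCharacter ℂ q,
      χ.IsPrimitive → χ.IsQuadratic → χ.Odd →
        ∀ (K : Type) [Field K] [NumberField K],
          Module.finrank ℚ K = 2 → NumberField.discr K = -(q : ℤ) →
            ∀ (ψ : ClassGroup (𝓞 K) →* ℂˣ) (T : ℝ) (S : Finset ℝ) (t' : ℝ → ℝ),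
              (q : ℝ) ^ (65 : ℕ) ≤ T → Real.exp (Real.log q ^ (2 : ℕ)) ≤ T → IsDyadicPointSet S T →
                defectE K ψ q S t' ≤
                  C * (T * Real.log q ^ (6 : ℕ) +
                    T * Real.sqrt (calL χ T) * Real.log T ^ (2 : ℕ) * Real.log q ^ ((5 : ℝ) / 2)) := by
  obtain ⟨C₁, hC₁, h81⟩ := h81
  obtain ⟨C₅, hC₅, h63⟩ := h63
  obtain ⟨C₃, hC₃, hx⟩ := hx
  obtain ⟨C₄, hC₄, hB⟩ := hB
  obtain ⟨C₂, hC₂, hM⟩ := sum_norm_shortInvSum_sq_le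
  refine ⟨Real.sqrt (C₁ * C₂) + 15000 * C₃ * C₄ * Real.sqrt C₅, by positivity,
    fun q _ hq hodd χ hprim hquad hoddχ K _ _ h2 hdisc ψ T S t' hT hexpT hS => ?_⟩
  classical
  have hq0 : 0 < q := by omega
  obtain ⟨hℓ1, hℓLT, hq4T, hq_le_T, hT0, hℓ_le_LT, hLT1⟩ := range_numerics hq hT hexpT
  have hqpos : (0 : ℝ) < q := by exact_mod_cast hq0
  have hT2 : (2 : ℝ) ≤ T := le_trans (by exact_mod_cast (by omega : 2 ≤ q)) hq_le_T
  obtain ⟨hL1q, hcLT, hcLq0, hcLq⟩ :=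
    calL_numerics hq χ hq_le_T (hL q hq χ hprim hquad hoddχ K h2 hdisc)
  obtain ⟨hxpt, hXB⟩ := xQuot_segment_le hC₃ hx hq hT2 hS t' hℓ_le_LT hLT1
  obtain ⟨hA₁, hBn₁, hA₂, hBn₂, hrq⟩ :=
    coeff_sums_le hq K ψ (hid hprim hquad hoddχ K h2 hdisc) hC₅ (h63 q hq χ hprim hquad hoddχ)
  -- Proposition 8.1 and the mollifier mean square
  have hD := h81 q hq hodd χ hprim hquad hoddχ K h2 hdisc ψ T S t' hT hexpT hS
  have hSM := hM q hq hodd χ hprim hquad hoddχ K h2 hdisc ψ T S hq4T hS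
  -- the separated bilinear bounds
  have hNT : ((q ^ 4 : ℕ) : ℝ) ≤ T := by push_cast; exact hq4T
  have hq2 : 2 ≤ q ^ 4 := by
    calc 2 ≤ 2 ^ 4 := by norm_num
      _ ≤ q ^ 4 := Nat.pow_le_pow_left (by omega) 4
  have hlog4 : Real.log ((q ^ 4 : ℕ) : ℝ) = 4 * Real.log q := by
    push_cast; rw [Real.log_pow]; push_cast; ring
  have hSB₁ := hB (q ^ 4) (q ^ 4) (q ^ 2 + 1) (q ^ 4) 1 (q ^ 4)
    (twistMoebius K (classGroupCharIdealHom ψ)) (twistCount K (classGroupCharIdealHom ψ)) T S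
    (Nat.le_add_left 1 _) le_rfl le_rfl le_rfl hq2 hT0 hNT hS
  have hSB₂ := hB (q ^ 4) (q ^ 4) 1 (q ^ 2) (q ^ 2 + 1) (q ^ 4)
    (twistMoebius K (classGroupCharIdealHom ψ)) (twistCount K (classGroupCharIdealHom ψ)) T S
    le_rfl (Nat.pow_le_pow_right hq0 (by norm_num)) (Nat.le_add_left 1 _) le_rfl hq2 hT0 hNT hS
  rw [hlog4] at hSB₁ hSB₂
  -- `E ≤ √D √(Σ|M|²) + X (Σ|B₁| + Σ|B₂|)`
  have hE := defectE_le_diag_offdiag K ψ q S t' (C₃ * (Real.log q + Real.log (2 * T)))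
    (fun t => hMN K ψ q hq0 (1 / 2 + t * I)) hxpt
  have hSB₁0 : 0 ≤ ∑ t ∈ S, ‖(∑ m ∈ Finset.Icc (q ^ 2 + 1) (q ^ 4), ∑ n ∈ Finset.Icc 1 (q ^ 4),
            if q ^ 4 < m * n then
              twistMoebius K (classGroupCharIdealHom ψ) m * (m : ℂ) ^ (-(1 / 2 + t * I)) *
                (twistCount K (classGroupCharIdealHom ψ) n * (n : ℂ) ^ (-(1 / 2 + t * I)))
            else 0)‖ := Finset.sum_nonneg fun _ _ => norm_nonneg _
  have hSB₂0 : 0 ≤ ∑ t ∈ S, ‖(∑ m ∈ Finset.Icc 1 (q ^ 2), ∑ n ∈ Finset.Icc (q ^ 2 + 1) (q ^ 4),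
            if q ^ 4 < m * n then
              twistMoebius K (classGroupCharIdealHom ψ) m * (m : ℂ) ^ (-(1 / 2 + t * I)) *
                (twistCount K (classGroupCharIdealHom ψ) n * (n : ℂ) ^ (-(1 / 2 + t * I)))
            else 0)‖ := Finset.sum_nonneg fun _ _ => norm_nonneg _
  -- assemble
  exact prop91_algebra hC₁ hC₂ hC₃ hC₄ hC₅ hT0.le hℓ1 hℓLT (norm_nonneg _) hqpos hL1q
    (Real.sqrt_nonneg _) hrq hcLq0 hcLq hcLT hE hD hSM hXB hSB₁0 hSB₂0 hSB₁ hSB₂ hA₁ hBn₁ hA₂ hBn₂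

/-! ### The separated bilinear mean value on dyadic point sets -/

/-- **`Σ_s|B_i(s)|` over a dyadic point set**: the tree's generic separated bilinear discrete mean
value (`HyperbolicSeparation.sum_norm_hyperbolic_bilinear_le`, constant `186`) for `1`-spaced points
of `(T, 2T]` — "`Σ_s|B(s)| ≪ T(log q)²(Σ_m τ²(m,χ)m^{−1})^{1/2}(Σ_n τ²(n)n^{−1})^{1/2}`".
[cite: ConreyIwaniec2002, §9 p. 20 (before (9.7))] -/
theorem bilinear_hyperbolic_dyadic :
    ∃ C : ℝ, 0 < C ∧
      ∀ (N X M₁ M₂ N₁ N₂ : ℕ) (a b : ℕ → ℂ) (T : ℝ) (S : Finset ℝ),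
        1 ≤ M₁ → M₂ ≤ N → 1 ≤ N₁ → N₂ ≤ N → 2 ≤ X → 0 < T → (N : ℝ) ≤ T →
          IsDyadicPointSet S T →
          ∑ t ∈ S, ‖∑ m ∈ Finset.Icc M₁ M₂, ∑ n ∈ Finset.Icc N₁ N₂,
              (if X < m * n then
                a m * (m : ℂ) ^ (-(1 / 2 + t * I)) * (b n * (n : ℂ) ^ (-(1 / 2 + t * I)))
               else 0)‖ ≤
            C * T * (1 + Real.log N) * (1 + Real.log X) *
              Real.sqrt (∑ m ∈ Finset.Icc M₁ M₂, ‖a m‖ ^ 2 / m) *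
              Real.sqrt (∑ n ∈ Finset.Icc N₁ N₂, ‖b n‖ ^ 2 / n) := by
  refine ⟨186, by norm_num, fun N X M₁ M₂ N₁ N₂ a b T S hM hMN hN hNN hX hT hNT hS => ?_⟩
  have hmem : ∀ t ∈ S, |t| ≤ 2 * T := by
    intro t ht
    have h := hS.mem_bounds ht
    rw [abs_of_pos (by linarith [h.1])]
    exact h.2
  exact HyperbolicSeparation.sum_norm_hyperbolic_bilinear_le a b hM hMN hN hNN hX hT hNT S hmem hS.2

/-! ### Proposition 9.1 (restricted) from the two named inputs -/

/-- **PROPOSITION 9.1 FOR `T ≥ q^65`, `log T ≥ (log q)²`, FROM PROPOSITION 8.1 (same range) AND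
COROLLARY 6.3.** "Let `S(T)` be a set of points satisfying (8.1)–(8.3) … Then
`E(T) ≪ T(log q)^6 + Tℒ(T)^{1/2}(log T)²(log q)^{5/2}` (9.7) where the implied constant is absolute" —
here for `1`-spaced `S ⊂ (T,2T]` with `q^65 ≤ T` and `e^{(log q)²} ≤ T`, GIVEN (8.10) in that range
and (6.49) as typed; every other ingredient of the printed proof is a tree theorem. The conclusion
is the binder `h1` of `principalEstimate_of` (Proposition 9.2) verbatim.
[cite: ConreyIwaniec2002, Proposition 9.1 (9.7)] -/
theorem prop91_large_of_prop81_large_corollary63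
    (h81 :
    ∃ C : ℝ, 0 < C ∧
    ∀ (q : ℕ) [NeZero q], 4 < q → Odd q → ∀ χ : DirichletCharacter ℂ q,
      χ.IsPrimitive → χ.IsQuadratic → χ.Odd →
        ∀ (K : Type) [Field K] [NumberField K],
          Module.finrank ℚ K = 2 → NumberField.discr K = -(q : ℤ) →
            ∀ (ψ : ClassGroup (𝓞 K) →* ℂˣ) (T : ℝ) (S : Finset ℝ) (t' : ℝ → ℝ),
              (q : ℝ) ^ (65 : ℕ) ≤ T → Real.exp (Real.log q ^ (2 : ℕ)) ≤ T → IsDyadicPointSet S T →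
                defectD K ψ q S t' ≤
                  C * (T * Real.log q ^ (7 : ℕ) + T * calL χ T * Real.log T ^ (4 : ℕ)))
    (h63 : conreyIwaniec2002_corollary63) :
    ∃ C : ℝ, 0 < C ∧
    ∀ (q : ℕ) [NeZero q], 4 < q → Odd q → ∀ χ : DirichletCharacter ℂ q,
      χ.IsPrimitive → χ.IsQuadratic → χ.Odd →
        ∀ (K : Type) [Field K] [NumberField K],
          Module.finrank ℚ K = 2 → NumberField.discr K = -(q : ℤ) →
            ∀ (ψ : ClassGroup (𝓞 K) →* ℂˣ) (T : ℝ) (S : Finset ℝ) (t' : ℝ → ℝ),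
              (q : ℝ) ^ (65 : ℕ) ≤ T → Real.exp (Real.log q ^ (2 : ℕ)) ≤ T → IsDyadicPointSet S T →
                defectE K ψ q S t' ≤
                  C * (T * Real.log q ^ (6 : ℕ) +
                    T * Real.sqrt (calL χ T) * Real.log T ^ (2 : ℕ) * Real.log q ^ ((5 : ℝ) / 2)) :=
  prop91_large_of h81 h63 norm_xQuot_le bilinear_hyperbolic_dyadic
    (fun hprim hquad hodd K _ _ h2 hdisc _ hn =>
      idealNormCount_eq_norm_divisorSumChar_of_quadratic hprim hquad hodd K h2 hdisc hn)
    (fun q _ hq χ hprim hquad hodd K _ _ h2 hdisc =>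
      norm_LFunction_one_ge q hq χ hprim hquad hodd K h2 hdisc)
    (fun K _ _ ψ q hq s => shortInvSum_mul_shortLSum_sub_one K ψ q hq s)

end ConreyIwaniec2002

open ConreyIwaniec2002 in
/-- **TREE EDGE OF RECORD: typed Proposition 8.1 ∧ typed Corollary 6.3 ⟹ Proposition 9.1 for
`T ≥ q^65`, `log T ≥ (log q)²`** (the printed inference "Proposition 8.1 + (6.49) ⟹ (9.7)",
p. 20 L1–44, with no other hypothesis). Together with the tree's
`conreyIwaniec2002_proposition92_of_proposition91`-chain (`principalEstimate_of`), this moves the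
fact boundary of Proposition 9.2 down to Proposition 8.1 and Corollary 6.3.
[cite: ConreyIwaniec2002, Proposition 9.1 (9.7)] -/
theorem prop91_large_of_proposition81_corollary63
    (h81 : conreyIwaniec2002_proposition81) (h63 : conreyIwaniec2002_corollary63) :
    ∃ C : ℝ, 0 < C ∧
    ∀ (q : ℕ) [NeZero q], 4 < q → Odd q → ∀ χ : DirichletCharacter ℂ q,
      χ.IsPrimitive → χ.IsQuadratic → χ.Odd →
        ∀ (K : Type) [Field K] [NumberField K],
          Module.finrank ℚ K = 2 → NumberField.discr K = -(q : ℤ) →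
            ∀ (ψ : ClassGroup (𝓞 K) →* ℂˣ) (T : ℝ) (S : Finset ℝ) (t' : ℝ → ℝ),
              (q : ℝ) ^ (65 : ℕ) ≤ T → Real.exp (Real.log q ^ (2 : ℕ)) ≤ T → IsDyadicPointSet S T →
                defectE K ψ q S t' ≤
                  C * (T * Real.log q ^ (6 : ℕ) +
                    T * Real.sqrt (calL χ T) * Real.log T ^ (2 : ℕ) * Real.log q ^ ((5 : ℝ) / 2)) :=
  prop91_large_of_prop81_large_corollary63 (prop81_large_of_proposition81 h81) h63

/-! ### Down the chain: Proposition 9.2 from Proposition 8.1, Corollary 6.3 (and the (9.11) claim) -/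

open ConreyIwaniec2002 in
/-- **Proposition 8.1 ∧ Corollary 6.3 ∧ the printed (9.11) claim ⟹ Proposition 9.2 (as typed,
BY NAME).** The typed `conreyIwaniec2002_proposition92` from the typed Proposition 8.1 and
Corollary 6.3 and the cosmetic claim `hLq` of (9.11) ("if `(log T)L(1,χ)^{1/2}(log q)^3 ≤ 1` then
`ℒ(T) ≪ L(1,χ)log q`"; HONEST LABEL as in `conreyIwaniec2002_proposition92_of_proposition91`: not in
print, open in the polylog regime) — the tree's `principalEstimate_of 3` fed with
`prop91_large_of_proposition81_corollary63`. [cite: ConreyIwaniec2002, Proposition 9.2 (9.12)] -/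
theorem conreyIwaniec2002_proposition92_of_proposition81_corollary63
    (h81 : conreyIwaniec2002_proposition81) (h63 : conreyIwaniec2002_corollary63)
    (hLq : ∃ C : ℝ, 0 < C ∧
      ∀ (q : ℕ) [NeZero q], 4 < q → ∀ χ : DirichletCharacter ℂ q,
        χ.IsPrimitive → χ.IsQuadratic → χ.Odd → ∀ T : ℝ, 2 ≤ T →
          Real.log T * Real.sqrt ‖χ.LFunction 1‖ * Real.log q ^ (3 : ℕ) ≤ 1 →
            calL χ T ≤ C * (‖χ.LFunction 1‖ * Real.log q)) :
    conreyIwaniec2002_proposition92 := by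
  -- `hLq` in the exponent-`e` form with `e = 3`
  have h4 : ∃ C : ℝ, 0 < C ∧
      ∀ (q : ℕ) [NeZero q], 4 < q → ∀ χ : DirichletCharacter ℂ q,
        χ.IsPrimitive → χ.IsQuadratic → χ.Odd → ∀ T : ℝ, 2 ≤ T →
          Real.log T * Real.sqrt ‖χ.LFunction 1‖ * Real.log q ^ (3 : ℝ) ≤ 1 →
            calL χ T ≤ C * (‖χ.LFunction 1‖ * Real.log q ^ (2 * (3 : ℝ) - 5)) := by
    obtain ⟨C, hC, h⟩ := hLq
    refine ⟨C, hC, fun q _ hq χ hprim hquad hodd T hT hsm => ?_⟩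
    have e3 : Real.log q ^ (3 : ℝ) = Real.log q ^ (3 : ℕ) := by
      rw [← Real.rpow_natCast]; norm_num
    have e1 : Real.log q ^ (2 * (3 : ℝ) - 5) = Real.log q := by norm_num
    rw [e1]
    rw [e3] at hsm
    exact h q hq χ hprim hquad hodd T hT hsm
  obtain ⟨C, hC, h⟩ := principalEstimate_of 3 (prop91_large_of_proposition81_corollary63 h81 h63) h4
  refine ⟨C, hC, fun q _ hq hodd χ hprim hquad hoddχ K _ _ hK hdisc ψ T S t' hT hS => ?_⟩
  have := h q hq hodd χ hprim hquad hoddχ K hK hdisc ψ T S t' hT hS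
  have e3 : Real.log q ^ (3 : ℝ) = Real.log q ^ (3 : ℕ) := by
    rw [← Real.rpow_natCast]; norm_num
  rw [e3] at this
  exact this

open ConreyIwaniec2002 NumberField in
/-- **Proposition 8.1 ∧ Corollary 6.3 ⟹ Proposition 9.2 with `(log q)^{7/2}` (FACT-FREE in (9.11)).**
The principal estimate (9.12) with the middle exponent `7/2` (the cosmetic step carried out with the
textbook `|L′(1,χ)| ≪ (log q)²`, tree `calL_le_of_small_weak`) from the typed Proposition 8.1 and
Corollary 6.3 ALONE — the unconditional-in-(9.11) output of the Conrey–Iwaniec chain §6–§9 as far as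
the tree holds it. [cite: ConreyIwaniec2002, Proposition 9.2 (9.12)] -/
theorem conreyIwaniec2002_proposition92_weak_of_proposition81_corollary63
    (h81 : conreyIwaniec2002_proposition81) (h63 : conreyIwaniec2002_corollary63) :
    ∃ C : ℝ, 0 < C ∧
    ∀ (q : ℕ) [NeZero q], 4 < q → Odd q → ∀ χ : DirichletCharacter ℂ q,
      χ.IsPrimitive → χ.IsQuadratic → χ.Odd →
        ∀ (K : Type) [Field K] [NumberField K],
          Module.finrank ℚ K = 2 → NumberField.discr K = -(q : ℤ) →
            ∀ (ψ : ClassGroup (𝓞 K) →* ℂˣ) (T : ℝ) (S : Finset ℝ) (t' : ℝ → ℝ),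
              2 ≤ T → IsPointSet S T →
                ∑ t ∈ S, sincTerm t (t' t) ≤
                  C * (T / Real.log T * Real.log q ^ (6 : ℕ) +
                    T * Real.log T * Real.sqrt ‖χ.LFunction 1‖ * Real.log q ^ ((7 : ℝ) / 2) +
                    Real.log q ^ ((5 : ℝ) / 2) / Real.log T *
                      Real.sqrt (T * ∑ t ∈ S, ‖dividedDifference (classGroupLFunction K ψ)
                        (1 / 2 + t * I) (1 / 2 + t' t * I)‖ ^ 2)) :=
  principalEstimate_of ((7 : ℝ) / 2) (prop91_large_of_proposition81_corollary63 h81 h63)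
    calL_le_of_small_weak

end Literature.NumberTheory.LFunctions

end
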